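import Summits.BirchSwinnertonDyer.BirchSwinnertonDyer.Theses.TangentCone
import Summits.BirchSwinnertonDyer.BirchSwinnertonDyer.Theorems.TamePinch.Negative.CMQuarticImage
import Literature.NumberTheory.EllipticCurves.ModPImageJ1728CartanProofs
import Literature.NumberTheory.EllipticCurves.DegreeConjectureAbcPrelims
import Literature.NumberTheory.EllipticCurves.SzpiroLocalDataProofs
import Mathlib.Algebra.Polynomial.SpecificDegree

/-!
# Disproof of `EdgeDecay` (stmt-BirchSwinnertonDyer-17608, route TangentCone) — findings

Crux (informal): for every elliptic `E/ℚ` (globally minimal `W`) with `r_an ≥ 2` and one big-image good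
ordinary prime `≥ 5` there are an ADMISSIBLE prime `p` (good ordinary, `a_p² ≢ 1`, `ρ̄` onto, (Br)) and a
slope `a/b < 1/2` such that the edge critical-value ratios `R = Λ(g_k,s_k)/Λ(g_k,j)` of the Hida-branch
newforms `g_k` decay `p`-adically at rate `≤ r_an`: `v_p(ι R) ≤ r_an·(m+1) + C` when `p^m ∣ k − 2`
(= Greenberg–Stevens total order `n_p(E) ≤ r_an(E)` along one rational arc through `(2,1)`).

## Findings of this cycle (cdisprove, cycle 1; seat refuter-cdisprove-stmt-BirchSwinnertonDyer-17608-0)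

* **F0 — THE WALL (`not_edgeDecay_imp_rank_two_witness`).** `¬ EdgeDecay` is *equivalent* to exhibiting a
  `W` with `2 ≤ W.analyticRank` (plus a big-image ordinary prime) at which the conclusion fails. The tree
  has NO curve of proved analytic rank `≥ 2` (`analyticRank` = order at `1` of `entireLFunction`, which is
  `L(E,s)` only under the unproved fact `hasEntireLFunction_rat`; `L(E,1) = L'(E,1) = 0` is proved for no
  curve). Hence no UNCONDITIONAL refutation of `EdgeDecay` can be landed in this tree whatever the
  mathematics; every negative result below is either about a dropped-hypothesis VARIANT, or a reduction.
* **F1 — read-back clean** (third independent pass; agrees with refuter stamps 02:32Z/05:07Z): `↑p − 1`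
  in `ℤ`; `s − 1`, `j − 1` are `ℕ`-safe (`s ≥ 1` forced by `b(s−1) = a(k−2)`, `b > 0`, `k ≥ 3`); `‖p‖ = p⁻¹`
  on `PadicAlgCl p` (Mathlib spectral norm); `IsNewform0` = new ∧ `T_p`-eigen (genuine double cosets,
  Mathlib `CuspForm.trace/translate`) ∧ `a₁ = 1` (blocks the scalar-multiple attack on (Br));
  `coeffField` = `ℚ(aₙ)` ⊆ `ℂ`; `W.LFunction` (Mathlib 2026, Browning) is the genuine Euler product over
  MINIMAL local models, so `a_n(f_E) = W.LFunction n` is the modularity identity at ALL `n` (Carayol) —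
  (Br)'s conclusion is satisfiable by `g = f_E`; `frobeniusTrace` enters only at primes `ℓ ∤ N·p` (good),
  where it is `a_ℓ` (its bad-prime values `2/0/1` — NOT `±1/0`, docstring of `reductionPointCount` is off by
  one — never enter this crux); `HasSurjectiveModNGaloisRep p` = onto `AddAut E[p] = GL₂(𝔽_p)`;
  `conductorNorm` = Ogg–Saito via Tate's algorithm, never `0` (so `NeZero` is dischargeable);
  quantifier order `∃p ∃(a,b) ∀J ∃C ∀m ∃(k,g,ι,s) ∀j` matches the informal rate statement.
* **F2 — (Br) is satisfiable at cofinitely many admissible `p`** (paper): level `M ∣ N`: finitely many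
  newforms, each `≠ f_E` differs at two primes `ℓ₁ ≠ ℓ₂ ∤ N` (strong multiplicity one), so congruent at only
  finitely many `p`; level `M = M'p`: a `p`-new weight-2 `g` has `a_p(g) = ±1` and `ρ_g|G_p ≅ (χε *; 0 χ)`,
  `χ` unramified, `χ(Frob_p) = a_p(g)`; `ρ̄_g ≅ ρ̄_E` forces the unramified quotient of `ρ̄_E|G_p`
  (`Frob_p ↦ a_p(E)`) to be `χ̄` (the other diagonal character `ωψ⁻¹` is ramified for `p ≥ 5`), i.e.
  `a_p(E) ≡ ±1 (mod p)` — excluded by `p ∤ a_p² − 1`; quadratic twists `f_E ⊗ χ` are never congruent to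
  `f_E` at a surjective `p ≥ 5` (the non-square-determinant coset of `GL₂(𝔽_p)` has elements of non-zero
  trace). So the `∃ p` is unobstructed by (Br). Conversely the decay clause's `∃ g` (a level-`N_E` NEWFORM of
  every branch weight) rests on constancy of the tame conductor along the branch (Hida 1986; vendored fact
  `hida_exists_congruent_ordinary_newform`, p138504): for `p ≥ 5` inertia images at potentially-good `ℓ`
  have order prime to `p` and the potentially-multiplicative monodromy does not drop at arithmetic points.
* **F3 — load-bearing hypotheses.** The crux has exactly four hypotheses on `W`: `IsElliptic`,
  `IsGloballyMinimal` (needed for `frobeniusTrace` to typecheck — cannot be dropped), `2 ≤ analyticRank`,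
  and the big-image prime `p₀`. (All conjuncts on `p` are OBLIGATIONS inside the `∃`, not hypotheses:
  dropping any of them only weakens `EdgeDecay` and shifts the burden to `EdgeCap`.)
  - big-image `p₀`: LOAD-BEARING — `edgeDecayWithoutBigImage_false_of_rankTwoCM41`: the variant without it is
    false as soon as the CM curve `y² = x³ − 41²x` (congruent number 41, root number `+1`, a rational point
    of infinite order, hence `r_an ≥ 2` by Coates–Wiles + parity) has `2 ≤ analyticRank` — a TRUE but
    tree-unconstructible `Prop` (`RankTwoCM41`); the kill is the landed negative 15532 mechanism
    (no odd prime is surjective for `j = 1728`; imported `tamePinch_not_hasSurjectiveModNGaloisRep_quartic`).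
  - `2 ≤ analyticRank`: NOT load-bearing for truth — `EdgeDecayWithoutRankTwo` is Greenberg–Stevens'
    degree statement in ranks `0` (GS93 Thm 7.1: TRUE at non-anomalous `p`) and `1` (conjecturally true,
    Schneider-type); it is there only for the PAdicHeightBarrier bookkeeping. No prover step may rely on it
    except through UB (`s_p ≤ r_an`), which holds in every rank.
* **F4 — reduction = the census verdict as a theorem** (`selmerUB_at_admissible_of_edgeDecay_of_edgeCap`,
  extracted from the certified `closes`): `EdgeDecay ∧ EdgeCap ⇒` for every rank-`≥ 2` big-image curve
  there is an admissible `p` with `corank_ℤₚ Sel_p∞ ≤ r_an`. Contrapositive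
  (`edgeDecay_false_of_edgeCap_of_corankExcess`): granted `EdgeCap`, ONE curve whose Selmer corank exceeds
  `r_an` at EVERY admissible prime (e.g. `Ш[p^∞]` infinite at all of them, or `r_MW > r_an`) kills
  `EdgeDecay`. So the `r_an` in the exponent is load-bearing exactly as the UB half of Selmer-rank BSD.
* **F5 — typing traps a proof must step around** (all sorry-free below): the branch congruence forces
  `4 ∣ k − 2` (`four_dvd_weight_sub_two`), so the centre `k/2` is ODD and, whenever `k ≤ 4J + 2`, it is one
  of the tested denominators `j` (`central_index_tested`) — for a branch of root number `−1`,
  `Λ(g_k, k/2) = 0`, `R = x/0 = 0` in Lean and the inequality fails (`not_decay_of_ratio_eq_zero`): the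
  witness `k` MUST be taken `> 4J + 2` (it is existential, so this is free); the line equation forces
  `s` odd with `2(p−1)p^m a ∣ s − 1` (`linePoint_parity`), i.e. `(k,s) → (2,1)` inside ONE tame component —
  consistent; any witness has `Λ(g,s) ≠ 0 ≠ Λ(g,j)` (`decay_witness_num_den_ne_zero`).
* **F6 — natural strengthenings** (paper only; no Lean object for newforms of weight `k > 2`): closed slope
  interval `2a ≤ b` is FALSE on every branch of root number `−1` (central zeros forced, `R = 0`); "at EVERY
  admissible `p`" (birth skeleton's `DecayAtEveryAdmissiblePrime`) and "C independent of J" are as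
  unrefutable as the crux (exact `p`-adic vanishing is not finitely certifiable; all numerics — 2001 Cor D
  27 pairs, job j023419 λ_p = r_an for 17 rank-2/3 curves — point the other way).
* **F7 — why it resists (substance).** Given EdgeCap-technology (Ochiai + control: rate `≥ s_p`) the crux
  at `p` is `n_p ≤ r_an`, i.e. UB at `p` plus pencil non-degeneracy `(det H_cyc, Pf A) ≠ (0,0)` plus
  `Ш[p^∞]`-cotorsion at ONE admissible `p` (Literature.Barriers…WeightHeightMinusHalfCyclotomic, rank 2:
  `4 det G = (2v−u)² det H_cyc + u² Pf(A)²`). A counterexample needs EXACT vanishing of a `p`-adic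
  regulator-type quantity at every admissible prime of one curve — uncertifiable by computation, contradicted
  by every table; a proof needs a rank-`≥ 2` `p`-adic Gross–Zagier — unknown. Neither side is reachable; the
  typed statement is faithful, so there is no mis-statement kill either.

## Landed / proposed from this file (Theorems/EdgeDecay/Negative/, `--supports` the crux)
* p147020 `EdgeDecayReductionToUB.lean` — §2 (`selmerUB_at_admissible_of_edgeDecay_of_edgeCap`,
  `edgeDecay_false_of_edgeCap_of_corankExcess`);
* p147026 → resubmitted (dedup bounce: CM mechanism already importable) `EdgeDecayFalseWithoutBigImage.lean` — §1
  (`edgeDecay_false_without_bigImage_of_rank`, `isGloballyMinimal_E41`);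
* p147030 `EdgeDecayWitnessTraps.lean` — §3.
Compute: j023856 (PARI, done/ok): `E₄₁ = [0,0,0,−1681,0]` has conductor `53792`, is already minimal
(`ellglobalred` change `[1,0,0,0]`), `Δ = 2⁶·41⁶`, root number `+1`, `ellanalyticrank = 2` (leading coefficient
`16.4310…`), and `ellrank = [2, 2]` with independent points `(−9,120)`, `(841,24360)` — so `RankTwoCM41` is TRUE
(rank `2 ⇒ L(E₄₁,1) = 0` by Coates–Wiles, parity even, numerically exactly `2`). Literature: local searchd down this session (search-degraded); prior
seats' searches stand (GS93, Delbourgo2008, Ochiai, Venerucci2016, BD2007: no negative instance in print).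
-/

noncomputable section

set_option linter.dupNamespace false

open scoped Classical MatrixGroups
open Matrix Polynomial WeierstrassCurve
open Literature.NumberTheory.EllipticCurves Literature.NumberTheory.GaloisRepresentations
open Summit.BirchSwinnertonDyer.BirchSwinnertonDyer.Theses.TangentCone

namespace Summit.BirchSwinnertonDyer.BirchSwinnertonDyer.Cruxes.EdgeDecay.Disproof

/-! ## §0 Anatomy of the crux and the wall -/

/-- The CONCLUSION of `EdgeDecay` at a curve `W` (verbatim: admissible prime `p` with (Br), slope
`a/b < 1/2`, and the decay clause). [folklore] -/
def Conclusion (W : WeierstrassCurve ℚ) [W.IsGloballyMinimal] : Prop :=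
  ∃ (_ : NeZero (W.conductorNorm ℤ)) (p : ℕ) (_ : Fact p.Prime), 5 ≤ p ∧ W.HasGoodReductionAtPrime p ∧ ¬ (p : ℤ) ∣ W.frobeniusTrace p ∧ ¬ (p : ℤ) ∣ (W.frobeniusTrace p) ^ 2 - 1 ∧ W.HasSurjectiveModNGaloisRep p ∧ (∀ (M : ℕ) (_ : NeZero M) (g : CuspForm (CongruenceSubgroup.Gamma0 M) 2) (ι : Literature.NumberTheory.EllipticCurves.ModularForms.coeffField g →+* PadicAlgCl p), M ∣ W.conductorNorm ℤ * p → Literature.NumberTheory.EllipticCurves.ModularForms.IsNewform0 g → ‖ι ⟨(UpperHalfPlane.qExpansion 1 ⇑g).coeff p, Literature.NumberTheory.EllipticCurves.ModularForms.coeff_mem_coeffField g p⟩‖ = 1 → (∀ ℓ : ℕ, ℓ.Prime → ¬ ℓ ∣ W.conductorNorm ℤ * p → ‖ι ⟨(UpperHalfPlane.qExpansion 1 ⇑g).coeff ℓ, Literature.NumberTheory.EllipticCurves.ModularForms.coeff_mem_coeffField g ℓ⟩ - ((W.frobeniusTrace ℓ : ℤ) : PadicAlgCl p)‖ < 1) →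 M = W.conductorNorm ℤ ∧ ∀ n : ℕ, (UpperHalfPlane.qExpansion 1 ⇑g).coeff n = ((W.LFunction n : ℤ) : ℂ)) ∧ ∃ (a b : ℕ), 0 < b ∧ 2 * a < b ∧ ∀ J : ℕ, ∃ C : ℕ, ∀ m : ℕ, ∃ (k : ℤ) (g : CuspForm (CongruenceSubgroup.Gamma0 (W.conductorNorm ℤ)) k) (ι : Literature.NumberTheory.EllipticCurves.ModularForms.coeffField g →+* PadicAlgCl p) (s : ℕ), (2 * b * (p - 1) * p ^ m : ℤ) ∣ (k - 2) ∧ (2 * J + 3 : ℤ) ≤ k ∧ (b : ℤ) * ((s : ℤ) - 1) = a * (k - 2) ∧ Literature.NumberTheory.EllipticCurves.ModularForms.IsNewform0 g ∧ ‖ι ⟨(UpperHalfPlane.qExpansion 1 ⇑g).coeff p, Literature.NumberTheory.EllipticCurves.ModularForms.coeff_mem_coeffField g p⟩‖ = 1 ∧ (∀ ℓ : ℕ, ℓ.Prime → ¬ ℓ ∣ W.conductorNorm ℤ * p → ‖ι ⟨(UpperHalfPlane.qExpansion 1 ⇑g).coeff ℓ, Literature.NumberTheory.EllipticCurves.ModularForms.coeff_mem_coeffField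 g ℓ⟩ - ((W.frobeniusTrace ℓ : ℤ) : PadicAlgCl p)‖ < 1) ∧ ∀ (j : ℕ), Odd j → 3 ≤ j → j ≤ 2 * J + 1 → ∃ hR : (∫ t in Set.Ioi (0 : ℝ), ((t : ℂ) ^ (s - 1)) * g (UpperHalfPlane.ofComplex ((t : ℂ) * Complex.I))) / (∫ t in Set.Ioi (0 : ℝ), ((t : ℂ) ^ (j - 1)) * g (UpperHalfPlane.ofComplex ((t : ℂ) * Complex.I))) ∈ Literature.NumberTheory.EllipticCurves.ModularForms.coeffField g, 1 ≤ ‖ι ⟨_, hR⟩‖ * (p : ℝ) ^ (W.analyticRank * (m + 1) + C)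

/-- The big-image hypothesis of `EdgeDecay` at `W` (one good ordinary prime `p₀ ≥ 5` with `ρ̄_{E,p₀}`
onto). [folklore] -/
def BigImageHyp (W : WeierstrassCurve ℚ) [W.IsGloballyMinimal] : Prop :=
  (∃ (p₀ : ℕ) (_ : Fact p₀.Prime), 5 ≤ p₀ ∧ W.HasGoodReductionAtPrime p₀ ∧ ¬ (p₀ : ℤ) ∣ W.frobeniusTrace p₀ ∧ W.HasSurjectiveModNGaloisRep p₀)

/-- `EdgeDecay` unfolded into hypotheses → `Conclusion` (definitional). [folklore] -/
theorem edgeDecay_iff :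
    EdgeDecay ↔ ∀ (W : WeierstrassCurve ℚ) [W.IsElliptic] [W.IsGloballyMinimal],
      2 ≤ W.analyticRank → BigImageHyp W → Conclusion W :=
  Iff.rfl

/-- **The wall (F0).** Refuting `EdgeDecay` is the same as producing a globally minimal elliptic `W`
with PROVED `2 ≤ W.analyticRank` and a big-image ordinary prime at which the conclusion fails. No curve of
proved analytic rank `≥ 2` exists in the tree, so no unconditional `¬ EdgeDecay` can be landed. [folklore] -/
theorem not_edgeDecay_iff_witness :
    ¬ EdgeDecay ↔ ∃ (W : WeierstrassCurve ℚ) (_ : W.IsElliptic) (_ : W.IsGloballyMinimal),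
      2 ≤ W.analyticRank ∧ BigImageHyp W ∧ ¬ Conclusion W := by
  rw [edgeDecay_iff]
  constructor
  · intro h
    by_contra hw
    apply h
    intro W _ _ hr hb
    by_contra hc
    exact hw ⟨W, ‹_›, ‹_›, hr, hb, hc⟩
  · rintro ⟨W, _, _, hr, hb, hc⟩ h
    exact hc (h W hr hb)

/-! ## §1 Load-bearing analysis (a): the big-image hypothesis -/

/-- `EdgeDecay` with the big-image hypothesis DROPPED (everything else verbatim). [folklore] -/
def EdgeDecayWithoutBigImage : Prop :=
  ∀ (W : WeierstrassCurve ℚ) [W.IsElliptic] [W.IsGloballyMinimal], 2 ≤ W.analyticRank → Conclusion W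

/-- `EdgeDecay` with the rank hypothesis `2 ≤ W.analyticRank` DROPPED. NOT refuted and believed TRUE:
in rank `0` it is Greenberg–Stevens 1993 Thm 7.1 (`L_p(2,1) = (1−α⁻¹)² L(E,1)/Ω ≠ 0` at non-anomalous
`p`), in rank `1` it is the Schneider-type non-vanishing of the linear term. Recorded to tell provers that
`2 ≤ analyticRank` is bookkeeping (PAdicHeightBarrier), not leverage. [cite: GreenbergStevens1993, Thm 7.1] -/
def EdgeDecayWithoutRankTwo : Prop :=
  ∀ (W : WeierstrassCurve ℚ) [W.IsElliptic] [W.IsGloballyMinimal], BigImageHyp W → Conclusion W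

/-- Both variants imply the crux (dropping a hypothesis strengthens). [folklore] -/
theorem edgeDecay_of_withoutBigImage (h : EdgeDecayWithoutBigImage) : EdgeDecay :=
  fun W _ _ hr _ => h W hr

/-- [folklore] -/
theorem edgeDecay_of_withoutRankTwo (h : EdgeDecayWithoutRankTwo) : EdgeDecay :=
  fun W _ _ _ hb => h W hb

/-- The CM curve `E₄₁ : y² = x³ − 1681 x` (`1681 = 41²`; the congruent-number curve of `n = 41`,
CM by `ℤ[i]`, `Δ = 2⁶·41⁶`). [folklore] -/
def E41 : WeierstrassCurve ℚ := ⟨0, 0, 0, -1681, 0⟩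

/-- `E₄₁` is an elliptic curve. [folklore] -/
instance isElliptic_E41 : E41.IsElliptic := isElliptic_quartic (by norm_num)

/-- The integral model of `E₄₁` base-changes to the rational one. [folklore] -/
theorem baseChange_E41 :
    ((⟨0, 0, 0, -1681, 0⟩ : WeierstrassCurve ℤ).baseChange ℚ) = E41 := by
  simp only [E41, WeierstrassCurve.baseChange, WeierstrassCurve.map]
  ext <;> simp

/-- `E₄₁` is globally minimal: `Δ = 2⁶·41⁶ = 304006671424` is `12`-th-power free
(Silverman AEC VII.1.1). [folklore] -/
instance isGloballyMinimal_E41 : E41.IsGloballyMinimal := by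
  rw [← baseChange_E41]
  refine isGloballyMinimal_of_forall_isMinimalAt_int _ fun v ↦ ?_
  refine isMinimalAt_baseChange_int_of_not_pow_dvd_Δ ?_
  intro h
  have hΔ : (⟨0, 0, 0, -1681, 0⟩ : WeierstrassCurve ℤ).Δ = 2 ^ 6 * 41 ^ 6 := by
    simp only [WeierstrassCurve.Δ, WeierstrassCurve.b₂, WeierstrassCurve.b₄, WeierstrassCurve.b₆,
      WeierstrassCurve.b₈]
    norm_num
  rw [hΔ] at h
  have hp := Rat.HeightOneSpectrum.prime_natGenerator v
  set q := Rat.HeightOneSpectrum.natGenerator v with hq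
  have h' : q ^ 12 ∣ 2 ^ 6 * 41 ^ 6 := by exact_mod_cast h
  have hq2 : q ∣ 2 ^ 6 * 41 ^ 6 := (dvd_pow_self q (by norm_num)).trans h'
  have hq' : q = 2 ∨ q = 41 := by
    rcases (Nat.Prime.dvd_mul hp).mp hq2 with h2 | h41
    · exact Or.inl ((Nat.prime_dvd_prime_iff_eq hp Nat.prime_two).mp (hp.dvd_of_dvd_pow h2))
    · exact Or.inr ((Nat.prime_dvd_prime_iff_eq hp (by norm_num)).mp (hp.dvd_of_dvd_pow h41))
  rcases hq' with h2 | h41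
  · rw [h2] at h'; revert h'; norm_num [Nat.dvd_iff_mod_eq_zero]
  · rw [h41] at h'
    have hle : 41 ^ 12 ≤ 2 ^ 6 * 41 ^ 6 := Nat.le_of_dvd (by norm_num) h'
    norm_num at hle

/-- **H (true, not constructible in the tree).** `E₄₁` has analytic rank `≥ 2`: `41 ≡ 1 (mod 8)` is a
congruent number (so `E₄₁(ℚ)` has positive rank), the root number is `+1`, and `L(E₄₁,1) = 0` by
Coates–Wiles; hence `ord_{s=1} L(E₄₁,s) ≥ 2` (LMFDB 53792.? / Cremona: rank 2). In the tree
`analyticRank` is the order of `entireLFunction`, whose identification with `L(E,s)` needs the unproved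
continuation fact, and `L(E₄₁,1) = L'(E₄₁,1) = 0` is proved for no curve — so this `Prop` is a
HYPOTHESIS here. [cite: CoatesWiles1977] -/
def RankTwoCM41 : Prop := 2 ≤ E41.analyticRank

/-! ### The CM mechanism is the landed `Theorems.tamePinch_not_hasSurjectiveModNGaloisRep_quartic`
(negative 15532, module `Theorems/TamePinch/Negative/CMQuarticImage.lean`), imported. -/



/-- **F3 — the big-image hypothesis is load-bearing** (`_false_without_` modulo the true Prop
`RankTwoCM41`): without it the CM curve `E₄₁` (analytic rank `≥ 2` granted) must be served an admissible
prime `p ≥ 5` with `ρ̄_{E₄₁,p}` onto `GL₂(𝔽_p)`, which no odd prime is. Any proof of `EdgeDecay` must USE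
the hypothesis `∃ p₀` (it is what makes `W` non-CM). [folklore] -/
theorem edgeDecayWithoutBigImage_false_of_rankTwoCM41 (h41 : RankTwoCM41) :
    ¬ EdgeDecayWithoutBigImage := by
  intro h
  obtain ⟨-, p, hp, h5, -, -, -, hsurj, -⟩ := h E41 h41
  haveI := hp
  exact Theorems.tamePinch_not_hasSurjectiveModNGaloisRep_quartic (D := -1681) (by norm_num) p (by omega) hsurj

/-! ## §2 Reduction (F4): `EdgeDecay ∧ EdgeCap` is UB at one admissible prime -/

/-- The admissibility package of a prime `p` for `W` (verbatim conjuncts of the crux, (Br) included),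
followed by an arbitrary predicate `P p` in place of the decay clause. [folklore] -/
def AdmissibleAnd (W : WeierstrassCurve ℚ) [W.IsGloballyMinimal] (P : ℕ → Prop) : Prop :=
  ∃ (_ : NeZero (W.conductorNorm ℤ)) (p : ℕ) (_ : Fact p.Prime), (5 ≤ p ∧ W.HasGoodReductionAtPrime p ∧ ¬ (p : ℤ) ∣ W.frobeniusTrace p ∧ ¬ (p : ℤ) ∣ (W.frobeniusTrace p) ^ 2 - 1 ∧ W.HasSurjectiveModNGaloisRep p ∧ (∀ (M : ℕ) (_ : NeZero M) (g : CuspForm (CongruenceSubgroup.Gamma0 M) 2) (ι : Literature.NumberTheory.EllipticCurves.ModularForms.coeffField g →+* PadicAlgCl p), M ∣ W.conductorNorm ℤ * p → Literature.NumberTheory.EllipticCurves.ModularForms.IsNewform0 g → ‖ι ⟨(UpperHalfPlane.qExpansion 1 ⇑g).coeff p, Literature.NumberTheory.EllipticCurves.ModularForms.coeff_mem_coeffField g p⟩‖ = 1 → (∀ ℓ : ℕ, ℓ.Prime → ¬ ℓ ∣ W.conductorNorm ℤ * p → ‖ι ⟨(UpperHalfPlane.qExpansion 1 ⇑g).coeff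 ℓ, Literature.NumberTheory.EllipticCurves.ModularForms.coeff_mem_coeffField g ℓ⟩ - ((W.frobeniusTrace ℓ : ℤ) : PadicAlgCl p)‖ < 1) → M = W.conductorNorm ℤ ∧ ∀ n : ℕ, (UpperHalfPlane.qExpansion 1 ⇑g).coeff n = ((W.LFunction n : ℤ) : ℂ))) ∧ P p

/-- **F4 (census verdict, extracted from the certified `closes`).** `EdgeDecay` and `EdgeCap` together
give, for every globally minimal elliptic `W` of analytic rank `≥ 2` with a big-image ordinary prime, an
ADMISSIBLE prime `p` (with (Br)) at which `corank_ℤₚ Sel_p∞(E/ℚ) ≤ r_an(E)` — the UB half of Selmer-rank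
BSD at that prime. (So every proof of the crux is, modulo EdgeCap-technology, a proof of UB somewhere.)
[folklore] -/
theorem selmerUB_at_admissible_of_edgeDecay_of_edgeCap (hE : EdgeDecay) (hC : EdgeCap)
    (W : WeierstrassCurve ℚ) [W.IsElliptic] [W.IsGloballyMinimal] (h2 : 2 ≤ W.analyticRank)
    (hb : BigImageHyp W) :
    AdmissibleAnd W fun p => W.selmerCorank p ≤ W.analyticRank := by
  obtain ⟨hN, p, hp, h5', hgood', hord', hna, hsurj', hBr, a, b, hb0, hab, hJ⟩ := hE W h2 hb
  refine ⟨hN, p, hp, ⟨h5', hgood', hord', hna, hsurj', hBr⟩, ?_⟩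
  obtain ⟨J, C₁, hcap⟩ := hC W hN p h5' hgood' hord' hna hsurj' hBr a b hb0 hab
  obtain ⟨C₂, hm⟩ := hJ J
  have hp1 : (1 : ℝ) < (p : ℝ) := by exact_mod_cast hp.out.one_lt
  have hp0 : (0 : ℝ) < (p : ℝ) := lt_trans zero_lt_one hp1
  have key : ∀ m : ℕ, W.selmerCorank p * (1 + m) ≤ W.analyticRank * (m + 1) + (C₁ + C₂) := by
    intro m
    obtain ⟨k, g, ι, s, hdiv, hkJ, hs, hnew, hordg, hcong, hall⟩ := hm m
    have hdiv' : (2 * b * (p - 1) : ℤ) ∣ (k - 2) := (Dvd.intro _ rfl).trans hdiv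
    obtain ⟨j, hjodd, hj3, hjJ, hcapj⟩ := hcap k g ι s hdiv' hkJ hs hnew hordg hcong
    obtain ⟨hR, hlow⟩ := hall j hjodd hj3 hjJ
    have hup := hcapj hR
    have hk0 : (k - 2) ≠ 0 := by omega
    have hpm : ((p : ℤ) ^ m) ∣ (k - 2) := (Dvd.intro_left _ rfl).trans hdiv
    have hmv : m ≤ padicValInt p (k - 2) := by
      rcases (padicValInt_dvd_iff m (k - 2)).mp hpm with h | h
      · exact absurd h hk0
      · exact h
    set x : ℝ := ‖ι ⟨_, hR⟩‖ with hx
    set e₁ : ℕ := W.selmerCorank p * (1 + padicValInt p (k - 2)) with he₁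
    set e₂ : ℕ := W.analyticRank * (m + 1) + C₂ with he₂
    have hpow : (p : ℝ) ^ e₁ ≤ (p : ℝ) ^ (C₁ + e₂) := by
      calc (p : ℝ) ^ e₁ = (p : ℝ) ^ e₁ * 1 := by ring
        _ ≤ (p : ℝ) ^ e₁ * (x * (p : ℝ) ^ e₂) :=
            mul_le_mul_of_nonneg_left hlow (pow_nonneg hp0.le _)
        _ = (x * (p : ℝ) ^ e₁) * (p : ℝ) ^ e₂ := by ring
        _ ≤ (p : ℝ) ^ C₁ * (p : ℝ) ^ e₂ :=
            mul_le_mul_of_nonneg_right hup (pow_nonneg hp0.le _)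
        _ = (p : ℝ) ^ (C₁ + e₂) := (pow_add (p : ℝ) C₁ e₂).symm
    have hexp : e₁ ≤ C₁ + e₂ := (pow_le_pow_iff_right₀ hp1).mp hpow
    have hmono : W.selmerCorank p * (1 + m) ≤ e₁ :=
      Nat.mul_le_mul_left _ (by omega)
    omega
  have hk := key (C₁ + C₂)
  by_contra hlt
  push Not at hlt
  have h1 : (W.analyticRank + 1) * (1 + (C₁ + C₂)) ≤ W.selmerCorank p * (1 + (C₁ + C₂)) :=
    Nat.mul_le_mul_right _ hlt
  nlinarith

/-- A CORANK-EXCESS witness: a globally minimal elliptic `W` of analytic rank `≥ 2` with a big-image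
ordinary prime whose `p^∞`-Selmer corank EXCEEDS `r_an` at every admissible prime (with (Br)). Believed
not to exist (it contradicts Selmer-rank BSD); e.g. a curve with `Ш[p^∞]` infinite at every admissible
`p`, or with `rank E(ℚ) > r_an`. [folklore] -/
def CorankExcessWitness : Prop :=
  ∃ (W : WeierstrassCurve ℚ) (_ : W.IsElliptic) (_ : W.IsGloballyMinimal),
    2 ≤ W.analyticRank ∧ BigImageHyp W ∧ ¬ AdmissibleAnd W fun p => W.selmerCorank p ≤ W.analyticRank

/-- **F4, contrapositive.** Granted `EdgeCap` (the Ochiai/Kato-side cap), a single corank-excess curve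
refutes `EdgeDecay`: the analytic rank in the crux's exponent is load-bearing exactly as UB. [folklore] -/
theorem edgeDecay_false_of_edgeCap_of_corankExcess (hC : EdgeCap) (hX : CorankExcessWitness) :
    ¬ EdgeDecay := by
  rintro hE
  obtain ⟨W, _, _, h2, hb, hno⟩ := hX
  exact hno (selmerUB_at_admissible_of_edgeDecay_of_edgeCap hE hC W h2 hb)

/-! ## §3 Typing / tightness lemmas (F5): traps the existential witness must avoid -/

/-- The branch congruence `2b(p−1)p^m ∣ k − 2` with `p` odd forces `4 ∣ k − 2`: the weight is
`≡ 2 (mod 4)` and the centre `k/2` of the critical strip is ODD. [folklore] -/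
theorem four_dvd_weight_sub_two {p b m : ℕ} {k : ℤ} (hp : Odd p)
    (hdiv : (2 * b * (p - 1) * p ^ m : ℤ) ∣ (k - 2)) : (4 : ℤ) ∣ k - 2 := by
  obtain ⟨r, hr⟩ := hp
  have h2 : (2 : ℤ) ∣ (p : ℤ) - 1 := ⟨r, by push_cast [hr]; ring⟩
  obtain ⟨c, hc⟩ := h2
  have h4 : (4 : ℤ) ∣ (2 * b * (p - 1) * p ^ m : ℤ) := ⟨b * c * p ^ m, by rw [hc]; ring⟩
  exact h4.trans hdiv

/-- **Trap.** If the witness weight is small, `k ≤ 4J + 2`, then the CENTRAL critical point `j = k/2` is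
among the tested denominators (`j` odd, `3 ≤ j ≤ 2J + 1`). On a Hida branch of root number `−1` the central
value `Λ(g_k, k/2)` vanishes, the Lean ratio `x / 0 = 0` has norm `0`, and the decay inequality fails
(`not_decay_of_ratio_eq_zero`). Since `k` is existential the prover must (and may) take `k > 4J + 2`.
[folklore] -/
theorem central_index_tested {p b m J : ℕ} {k : ℤ} (hp : Odd p)
    (hdiv : (2 * b * (p - 1) * p ^ m : ℤ) ∣ (k - 2)) (hkJ : (2 * J + 3 : ℤ) ≤ k)
    (hsmall : k ≤ 4 * J + 2) :
    ∃ j : ℕ, Odd j ∧ 3 ≤ j ∧ j ≤ 2 * J + 1 ∧ (2 * j : ℤ) = k := by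
  obtain ⟨c, hc⟩ := four_dvd_weight_sub_two hp hdiv
  refine ⟨(2 * c + 1).toNat, ?_, ?_, ?_, ?_⟩
  · refine ⟨c.toNat, ?_⟩
    omega
  · omega
  · omega
  · omega

/-- The line equation `b(s − 1) = a(k − 2)` on the branch `2b(p−1)p^m ∣ k − 2` forces
`2a(p−1)p^m ∣ s − 1`: the point `s` is ODD (same sign component as the odd `j`, so periods cancel in
`Λ(g,s)/Λ(g,j)`), `s ≡ 1 (mod p − 1)` (same tame character) and `s → 1` `p`-adically together with
`k → 2` — the witness points do converge to `(2,1)` inside one component of weight-character space.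
Sanity, not an objection. [folklore] -/
theorem linePoint_parity {p a b m : ℕ} {k : ℤ} {s : ℕ} (hb : 0 < b)
    (hdiv : (2 * b * (p - 1) * p ^ m : ℤ) ∣ (k - 2)) (hs : (b : ℤ) * ((s : ℤ) - 1) = a * (k - 2)) :
    (2 * a * (p - 1) * p ^ m : ℤ) ∣ (s : ℤ) - 1 := by
  obtain ⟨t, ht⟩ := hdiv
  refine ⟨t, ?_⟩
  have hb' : (b : ℤ) ≠ 0 := by exact_mod_cast hb.ne'
  have : (b : ℤ) * ((s : ℤ) - 1) = b * (2 * a * (p - 1) * p ^ m * t) := by rw [hs, ht]; ring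
  exact mul_left_cancel₀ hb' this

/-- In particular `s` is odd whenever `a(p−1)` is an integer (always): `2 ∣ s − 1`. [folklore] -/
theorem linePoint_odd {p a b m : ℕ} {k : ℤ} {s : ℕ} (hb : 0 < b)
    (hdiv : (2 * b * (p - 1) * p ^ m : ℤ) ∣ (k - 2)) (hs : (b : ℤ) * ((s : ℤ) - 1) = a * (k - 2)) :
    Odd s := by
  obtain ⟨t, ht⟩ := linePoint_parity hb hdiv hs
  set X : ℤ := (a : ℤ) * (p - 1) * p ^ m * t with hX
  have h2 : (s : ℤ) - 1 = 2 * X := by rw [ht, hX]; ring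
  exact ⟨X.toNat, by omega⟩

/-- **Trap.** A zero ratio never satisfies the decay inequality: `‖ι 0‖ · p^e = 0 < 1`. [folklore] -/
theorem not_decay_of_ratio_eq_zero {K : Type*} [Field K] {L : Type*} [NormedField L]
    (ι : K →+* L) (c : ℝ) : ¬ (1 ≤ ‖ι 0‖ * c) := by
  simp

/-- Hence any decay witness has a NON-ZERO ratio, i.e. (Lean's `x / 0 = 0`) both the numerator
`Λ(g,s)` and the denominator `Λ(g,j)` are non-zero complex numbers. [folklore] -/
theorem decay_witness_num_den_ne_zero {K : IntermediateField ℚ ℂ} {L : Type*} [NormedField L]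
    (ι : K →+* L) {x y : ℂ} (hR : x / y ∈ K) {c : ℝ} (h : 1 ≤ ‖ι ⟨x / y, hR⟩‖ * c) :
    x ≠ 0 ∧ y ≠ 0 := by
  by_contra hxy
  have h0 : x / y = 0 := by
    rcases not_and_or.mp hxy with hx | hy
    · rw [not_not.mp hx, zero_div]
    · rw [not_not.mp hy, div_zero]
  have : (⟨x / y, hR⟩ : K) = 0 := Subtype.ext h0
  rw [this, map_zero, norm_zero, zero_mul] at h
  exact absurd h (by norm_num)

/-! ## §4 Natural strengthenings (F6) — paper only

* closed slope interval `2a ≤ b` (allowing the central line `s = k/2`): FALSE on every branch of root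
  number `−1` (forced central zeros ⇒ `R = 0` ⇒ `not_decay_of_ratio_eq_zero`); the crux's strict `2a < b`
  is exactly right. No Lean object for `g_k` (`k > 2`) exists, so this stays prose.
* "decay at EVERY admissible `p`" / "`C` uniform in `J`": unrefutable for the same reason as the crux
  (F7); numerics (2001 Cor D; j023419) support them.

## §5 Targets — none this cycle (`stuck_stubs = []`). Registered line `ub_schneider_squeeze` (7 stubs):
stubs 2–4 are verbatim open items (0130/0132/0536), 5–6 named facts, 1 and 7 theorem-grade; quick read of
stub 7's extra hypothesis `(padicLFunction f α).order ≤ n`: `padicLFunction` is a genuine modular-symbol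
construction (junk only through `ratPlusSymbol`/`limUnder`), non-zero by the Rohrlich fact, so the stub is
not vacuous; nothing to kill cheaply.

## §6 Near-misses — none beyond the wall (F0). -/

end Summit.BirchSwinnertonDyer.BirchSwinnertonDyer.Cruxes.EdgeDecay.Disproof

end
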